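import Literature.IUT.HodgeArakelov.GaloisPairRigidityNonVacuity
import Literature.IUT.HodgeArakelov.AbsTopMonoidsNonVacuity

/-!
# [IUTchII] §1, Corollary 1.11: NON-VACUITY of the target category `ℱ` (`Cor111Tuple`) — unconditionally,
# and as the VALUE of the Corollary 1.11 functor `ℛ → ℱ` at the reference pair `(Π^tp_{X̲̲_k}, G_k)`

Mochizuki, *Inter-universal Teichmüller theory II*, §1, Corollary 1.11, kurims manuscript (Dec. 2020)
p. 49 ll. 36–44 [claim: Mochizuki2012, status: disputed] (IUTchII §1 Cor 1.11, kurims p.49): "the data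
consisting of the triple `(Π, G, α)` …, the topological `G`-modules constituted by the domain and codomain
of `(*bs-Gal_{G,⊳})`, the topological `Π`-module constituted by the codomain of `(*bs-Gal_{G,Π})`, and the
poly-isomorphisms `(*bs-Gal_{G,⊳})` and `(*bs-Gal_{G,Π})` determines a functor `ℛ → ℱ`".  Record-only
vocabulary under the claim key `Mochizuki2012` (D-0012, disputed); abc-iut cell, layer L6, NON-VACUITY
CERTIFICATE (L6-lead §F v1.18p «NV-L6 WAVE») for the objects `Cor111Tuple` of `ℱ` (sub-DAG row S5 of
`plan/L6/SUBDAG-IUTchII-Cor-111.md`, `GaloisPairRigiditySubdag.lean`, holder abc-iut-w5-d089), which the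
INHABITATION CENSUS v3 of abc-iut-w5-d114 lists with zero producers (the census counts constants CONCLUDING in
the structure; the production path of record is the object part of a FUNCTOR, `cor111Functor(OfMapLD).obj`,
which it does not see).  PROOF-ONLY: no `def`, no `instance`, no named fact.

What the kernel says:

* `Cor111Tuple.nonempty` — `ℱ` has objects, unconditionally (DEGENERATE witness: trivial groups, the
  one-element poly-isomorphisms `{id}`).  Reason, stated honestly: an object of `ℱ` is a bare tuple of three
  commutative groups and two SETS of group isomorphisms — the record carries no law.
* `Cor111Tuple.exists_functor_obj` — the GENUINE-SHAPED witness: over every [AbsTopIII] output interface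
  `A : AbsTopMonoids S` (inhabited iff (H1) «`Δ ⊆ Π^tp_{X̲̲_k}` characteristic» ∧ (H2) «`Π^tp_{X̲̲_k}/Δ ≅ G_k`»,
  `AbsTopMonoids.nonempty_iff`, p417411), THE Corollary 1.11 functor of record over the tautological
  Galois-pair rigidity data (`cor111FunctorTautological`, `GaloisPairRigidityNonVacuity.lean`) takes the
  reference object `(Π^tp_{X̲̲_k}, G_k)` of `ℛ` to a tuple
  `(μ_Ẑ(G_k), μ_Ẑ(O^×(G_k)), (l·Δ_Θ)(Π^tp_{X̲̲_k}), (*bs-Gal_{G_k,⊳}), (*bs-Gal_{G_k,Π}))` whose two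
  poly-isomorphisms are NONEMPTY sets (`tautological_orbitA_nonempty`, `tautological_orbitB_nonempty`) and
  whose entries are, on the nose, `Λ(O^×(G_k))`, `Λ(O^×(G_k))`, `Λ(O^×(Π^tp_{X̲̲_k}/Δ))` (tautological
  `μ_Ẑ(G) := Λ(O^×(G))`, `(l·Δ_Θ)(Π) := Λ(O^×(Π/Δ))`).

HONEST LABEL: the rigidity data consumed are the DEGENERATE ones (identity `(*bs-Gal)`, trivial twist —
`GaloisPairRigidityNonVacuity.lean` says so); the genuine [AbsTopIII] Rmk. 3.2.1 / Cor. 1.10 (c) isomorphisms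
are the cell's MERGE-MAP row B12.  Nothing here bears on [IUTchIII] Cor. 3.12; no side is taken; typed ≠
proved elsewhere.
-/

noncomputable section

namespace Literature.IUT.HodgeArakelov

open CategoryTheory
open Literature.AnabelianGeometry.EtaleTheta

universe u

namespace Cor111Tuple

/-- **`ℱ` has objects, unconditionally (DEGENERATE witness)** (IUTchII Cor. 1.11, kurims p. 49): trivial
groups and the one-element poly-isomorphisms `{id}`.  An object of `ℱ` is a bare tuple — no law is carried.
[claim: Mochizuki2012, status: disputed] (IUTchII §1 Cor 1.11, kurims p.49) -/
theorem nonempty : Nonempty Cor111Tuple.{u} :=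
  ⟨@Cor111Tuple.mk PUnit.{u + 1} PUnit.{u + 1} PUnit.{u + 1} inferInstance inferInstance inferInstance
      {MulEquiv.refl _} {MulEquiv.refl _}⟩

/-- Exact inhabitation description: EVERY triple of commutative groups with two sets of isomorphisms is an
object of `ℱ` (the record carries no law). [claim: Mochizuki2012, status: disputed]
(IUTchII §1 Cor 1.11, kurims p.49) -/
theorem exists_of_sets (M U L : Type u) [CommGroup M] [CommGroup U] [CommGroup L] (a : Set (M ≃* U))
    (b : Set (M ≃* L)) :
    ∃ X : Cor111Tuple.{u}, X = @Cor111Tuple.mk M U L _ _ _ a b ∧ X.M = M ∧ X.U = U ∧ X.L = L :=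
  ⟨_, rfl, rfl, rfl, rfl⟩

variable {S : ThetaSetting.{u}}

/-- **The value of the Corollary 1.11 functor `ℛ → ℱ` at the reference pair `(Π^tp_{X̲̲_k}, G_k)`**
(IUTchII Cor. 1.11, kurims p. 49 ll. 36–44): over every `A : AbsTopMonoids S`, for every orbit group
`Γ ⊆ Ẑ^×` and twisting group `Γ'`, the functor of record over the tautological Galois-pair rigidity data sends
`(Π^tp_{X̲̲_k}, G_k)` to an object of `ℱ` whose entries are `Λ(O^×(G_k))`, `Λ(O^×(G_k))`, `Λ(O^×(Π^tp_{X̲̲_k}/Δ))`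
and whose poly-isomorphisms `(*bs-Gal_{G_k,⊳})`, `(*bs-Gal_{G_k,Π})` are NONEMPTY.  PROVED (the entries by
`rfl`; nonemptiness by `tautological_orbitA_nonempty` / `tautological_orbitB_nonempty`).
[claim: Mochizuki2012, status: disputed] (IUTchII §1 Cor 1.11, kurims p.49) -/
theorem exists_functor_obj (A : AbsTopMonoids S) (Γ : Subgroup ZHatUnits) (Γ' : Type u) [Group Γ'] :
    ∃ X : Cor111Tuple.{u},
      X = (cor111FunctorTautological A Γ Γ').obj
            (IsoClass.base S.PiX, (⟨S.Gk, ⟨ContinuousMulEquiv.refl S.Gk⟩⟩ : TwistedIsoClass S.Gk Γ')) ∧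
      X.M = A.muZhatUnits ⟨S.Gk, ⟨ContinuousMulEquiv.refl S.Gk⟩⟩ ∧
      X.U = A.muZhatUnits ⟨S.Gk, ⟨ContinuousMulEquiv.refl S.Gk⟩⟩ ∧
      X.L = A.muZhatUnits (A.quotObj (IsoClass.base S.PiX)) ∧
      X.orbA.Nonempty ∧ X.orbB.Nonempty :=
  ⟨_, rfl, rfl, rfl, rfl, tautological_orbitA_nonempty A Γ _, tautological_orbitB_nonempty A _ _⟩

/-- Hence, over every inhabited [AbsTopIII] output interface — i.e. (p417411) whenever (H1) `Δ ⊆ Π^tp_{X̲̲_k}` is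
carried onto itself by every automorphism of topological groups of `Π^tp_{X̲̲_k}` and (H2) `Π^tp_{X̲̲_k}/Δ ≅ G_k` —
`ℱ` has an object with NONEMPTY poly-isomorphisms produced by the Corollary 1.11 functor.
[claim: Mochizuki2012, status: disputed] (IUTchII §1 Cor 1.11, kurims p.49) -/
theorem exists_of_setting
    (hΔ : ∀ f : S.PiX ≃ₜ* S.PiX, S.DeltaX.map f.toMulEquiv.toMonoidHom = S.DeltaX)
    (hq : Nonempty (TopGroup.quot S.PiX S.DeltaX ≃ₜ* S.Gk)) (Γ : Subgroup ZHatUnits) (Γ' : Type u)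
    [Group Γ'] :
    ∃ X : Cor111Tuple.{u},
      X = (cor111FunctorTautological (AbsTopMonoids.degenerate hΔ hq) Γ Γ').obj
            (IsoClass.base S.PiX, (⟨S.Gk, ⟨ContinuousMulEquiv.refl S.Gk⟩⟩ : TwistedIsoClass S.Gk Γ')) ∧
      X.orbA.Nonempty ∧ X.orbB.Nonempty := by
  obtain ⟨X, hX, -, -, -, hA, hB⟩ := exists_functor_obj (AbsTopMonoids.degenerate hΔ hq) Γ Γ'
  exact ⟨X, hX, hA, hB⟩

end Cor111Tuple

end Literature.IUT.HodgeArakelov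

end
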